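import Summits.BirchSwinnertonDyer.Rank1Residual.Additive.TwistPartnerSignCertificateGauss
import HarnessLib

/-!
# The ONE-VALUE LAW for the E-normalised tame branch: ONE wild twisted symbol sum
# `S(κ) = Σ_b κ(b)[b/p^m]⁺_f` READS the first top coefficient of EVERY witness `B` of the
# interpolation package — `p·‖τ(ε,ψ_κ)‖·‖S(κ)‖ = p^c·‖κ(γ) − 1‖^k` iff `‖[T^k]B‖ = p^c` is the first
# coefficient at the bound — and conversely PREDICTS `ord_p S(κ)` from `(λ_an, μ_an)`
# (cell `b2b-bsdres`, sub-cell additive-p2 = X3♯(G-ord)/X4♯(G-ord), gen 27; part 1/3)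

HONEST FRAMING (cell `b2b-bsdres`, run/shared/lean/b2b/bsd-rank1-residual/, verbatim in every
file): the goal of the cell is to DELETE the COMBINATION-SHAPED residual classes of the
Birch–Swinnerton-Dyer formula for ALL analytic-rank `≤ 1` elliptic curves over `ℚ` — "full BSD
formula for every rank `≤ 1` curve in class `C`" assembled STRICTLY from published theorems — so
that the rank-`≤ 1` remainder becomes exactly the CONSTRUCTION-SHAPED classes, which are TYPED
(missing-input `Prop`s), NOT attempted. This is not "finishing BSD". Sub-cell additive-p2: the
classes X3♯(G-ord) / X4♯(G-ord) are CONSTRUCTION-SHAPED and stay so; labels / RESIDUAL-MAP marks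
UNCHANGED; nothing is booked. THEOREMS ONLY (pure `p`-adic algebra + the interpolation row of
cc-typer-2's `IsTameBranchOf`); no definition, no named fact, no `sorry`.

## What and why

Gen 24's certificate for the λ-invariant of the tame branch on defect 3, 4, 6 reads ONE Riemann sum
of the forced partner (`‖RS k n‖ = p^c ⟹ ‖[T^k]B‖ = p^c`); gen 26 observed (E-GAUSSCERT 12/12 at
conductor `p²`, E-GAUSSCERT3 13/13 at `p³`, EVIDENCE) the law
`ord_p S(κ) = λ_an/φ + [1/e ∣ 1 − 1/e]` for the wild twisted symbol sums themselves and asked for it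
as a theorem. This file proves the character-blind core — additive-p3's ONE-VALUE CERTIFICATE for
`G ∈ Λ` (`Iwasawa/LambdaInvariantValuationLayer.lean`, Weierstrass preparation) redone ELEMENTARILY
for BOUNDED RATIONAL series `B ∈ ℚ_p⟦T⟧` with a coefficient bound `p^c` (the currency of gen 24's
at-the-bound discharge `charLamLeAt_of_tameBranchRatDvdAt_of_norm_le_pow_of_norm_coeff_eq_pow`; no
integral model, no `μ`/`λ` of `Λ` needed), and its instance on the interpolation row
`B(κ(γ) − 1) = α^{−m} p⁻¹ τ(ε,ψ_κ) S(κ)` of `IsTameBranchOf f p ε α B`: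

* §1 (pure; `b : ℕ → ℚ_p` bounded by `M`, `‖z‖ < 1` in `ℂ_p`, `Σ_k b_k z^k = V`):
  - `norm_eq_of_hasSum_of_firstTop`: if `‖b_k‖ = M`, `p·‖b_i‖ ≤ M` for `i < k` and `‖z‖^k > p⁻¹`
    then **`‖V‖ = M·‖z‖^k`** (the `k`-th term dominates strictly; ultrametric equality);
  - with the bound `M = p^c` (discreteness of `‖·‖` on `ℚ_p`: `‖x‖ < p^c ⟹ p‖x‖ ≤ p^c`):
    `exists_firstTop_of_lt_norm` (**`‖V‖ > p^{c−1}` ⟹ ∃ k with `‖z‖^k > p⁻¹`, `‖b_k‖ = p^c` first,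
    `‖V‖ = p^c‖z‖^k`**), `firstTop_of_norm_eq` (**`‖V‖ = p^c‖z‖^k`, `‖z‖^k > p⁻¹` ⟹ `‖b_k‖ = p^c` and
    `‖b_i‖ < p^c` for `i < k`**), and the undetermined regime
    `norm_le_iff_forall` (`‖V‖ ≤ p^{c−1} ↔` no coefficient reaches `p^c` at an index `k` with
    `‖z‖^k > p⁻¹`).
* §2 (the row; EVERY witness `B` of `IsTameBranchOf f p ε α B`, `‖α‖ = 1`, coefficient bound `p^c`,
  `κ` even primitive wild of conductor `p^m ≥ p²` and `p`-power order):
  **`IsTameBranchOf.mul_norm_tameGaussSum_mul_norm_eq_of_firstTop`** (first top coefficient at `k`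
  with `‖κ(γ)−1‖^k > p⁻¹` ⟹ `p‖τ(ε,ψ_κ)‖‖S(κ)‖ = p^c‖κ(γ)−1‖^k` — gen 26's `≤ p^c` made EXACT),
  **`IsTameBranchOf.firstTop_of_mul_norm_tameGaussSum_mul_norm_eq`** (the converse: ONE VALUE
  certifies `‖[T^k]B‖ = p^c`, all earlier coefficients below the bound), `…exists_firstTop_of_lt…`,
  `…_le_iff_forall…`.
* Part 2 (`TameBranchOneValueLayer.lean`) puts `κ` on a LAYER (conductor `p^{n+1+e₀}`,
  `‖κ(γ)−1‖^{φ(pⁿ⁺¹)} = p⁻¹`: `(p‖τ‖‖S(κ)‖)^{φ} = (p^c)^{φ}·p^{−k}` ⟺ first top coefficient at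
  `k < φ(pⁿ⁺¹)`) and makes `‖τ‖` explicit by Stickelberger (`[1/e ∣ 1 − 1/e]`); part 3
  (`TameBranchOneValueCertificateJoin.lean`) feeds the certificate into `CharLamLeAt`.

Not claimed: anything about which character / unit carries a witness (parts 2/3); any `μ`-statement
for `char_Λ X`; any booking.

References: Mazur–Tate–Teitelbaum 1986 §I.8, §I.13–I.14 [MazurTateTeitelbaum1986Invent];
Washington, GTM 83, §7.1–7.2 [Washington1997] (attribution of the Λ-level statement; the proofs here
are elementary and self-contained); HOME/b2b-bsdres-additive-p2/gen26/GAUSSCERT-CHECK.md,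
GAUSSCERT3-RESULT.md (the evidence this file turns into a prediction). -/

set_option autoImplicit false

noncomputable section

open scoped Classical MatrixGroups ModularForm NumberField Topology

open CongruenceSubgroup IsDedekindDomain WeierstrassCurve NumberField Filter
  Literature.NumberTheory.EllipticCurves
  Literature.NumberTheory.EllipticCurves.ModularForms
  Literature.NumberTheory.EllipticCurves.Rank1Residual
  Literature.NumberTheory.GaussSums

namespace Summit.BirchSwinnertonDyer.Rank1Residual.Additive

/-! ### §1 Bounded rational power series evaluated at small radius (pure `p`-adic algebra) -/

namespace TameBranchOneValue

section Eval

variable {p : ℕ} [hp : Fact p.Prime]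

/-- **Discreteness of `‖·‖_p` on `ℚ_p`**: `‖x‖ < p^c ⟹ p·‖x‖ ≤ p^c`. [folklore] -/
theorem mul_norm_le_pow_of_norm_lt_pow {x : ℚ_[p]} {c : ℕ} (h : ‖x‖ < (p : ℝ) ^ c) :
    (p : ℝ) * ‖x‖ ≤ (p : ℝ) ^ c := by
  have hp0 : (p : ℝ) ≠ 0 := Nat.cast_ne_zero.mpr hp.out.ne_zero
  have h' : ‖x‖ < (p : ℝ) ^ (c : ℤ) := by rwa [zpow_natCast]
  rw [Padic.norm_lt_pow_iff_norm_le_pow_sub_one] at h'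
  calc (p : ℝ) * ‖x‖ ≤ (p : ℝ) * (p : ℝ) ^ ((c : ℤ) - 1) := by gcongr
    _ = (p : ℝ) ^ (c : ℤ) := by rw [mul_comm, ← zpow_add_one₀ hp0, sub_add_cancel]
    _ = (p : ℝ) ^ c := zpow_natCast _ _

/-- A convergent series in `ℂ_p` with all terms of norm `≤ C` has sum of norm `≤ C`. [folklore] -/
theorem norm_le_of_hasSum_of_forall_norm_le {g : ℕ → ℂ_[p]} {V : ℂ_[p]} {C : ℝ} (hC : 0 ≤ C)
    (hg : ∀ k, ‖g k‖ ≤ C) (h : HasSum g V) : ‖V‖ ≤ C := by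
  rw [← h.tsum_eq]
  exact IsUltrametricDist.norm_tsum_le_of_forall_le_of_nonneg hC hg

/-- **The dominant term.** `b : ℕ → ℚ_p` with `‖b_j‖ ≤ M` for all `j`, `p·‖b_i‖ ≤ M` for `i < k`,
`‖b_k‖ = M > 0`; `z ∈ ℂ_p` with `‖z‖ < 1` and `‖z‖^k > p⁻¹`; `Σ_j b_j z^j = V`. Then
**`‖V‖ = M·‖z‖^k`**: every other term is `≤ max(M/p, M‖z‖^{k+1}) < M‖z‖^k`.
[cite: Washington1997, §7.1 (shape: the λ-term dominates inside the critical radius)] -/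
theorem norm_eq_of_hasSum_of_firstTop {b : ℕ → ℚ_[p]} {z V : ℂ_[p]} {M : ℝ} {k : ℕ}
    (hbd : ∀ j, ‖b j‖ ≤ M) (hsmall : ∀ i < k, (p : ℝ) * ‖b i‖ ≤ M) (hk : ‖b k‖ = M) (hM : 0 < M)
    (hz : ‖z‖ < 1) (hzk : (p : ℝ)⁻¹ < ‖z‖ ^ k)
    (h : HasSum (fun j ↦ algebraMap ℚ_[p] ℂ_[p] (b j) * z ^ j) V) :
    ‖V‖ = M * ‖z‖ ^ k := by
  have hp0 : (0 : ℝ) < p := by exact_mod_cast hp.out.pos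
  have hzk0 : 0 < ‖z‖ ^ k := lt_trans (inv_pos.mpr hp0) hzk
  set T : ℕ → ℂ_[p] := fun j ↦ algebraMap ℚ_[p] ℂ_[p] (b j) * z ^ j with hT_def
  have hT : ∀ j, ‖T j‖ = ‖b j‖ * ‖z‖ ^ j := fun j ↦ by
    simp only [hT_def, norm_mul, norm_algebraMap', norm_pow]
  -- a common bound for the non-dominant terms
  set M' : ℝ := max ((p : ℝ)⁻¹ * M) (M * ‖z‖ ^ (k + 1)) with hM'_def
  have hM'0 : 0 ≤ M' := le_max_of_le_left (by positivity)
  have hM'lt : M' < M * ‖z‖ ^ k := by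
    refine max_lt ?_ ?_
    · calc (p : ℝ)⁻¹ * M < ‖z‖ ^ k * M := by gcongr
        _ = M * ‖z‖ ^ k := mul_comm _ _
    · rw [pow_succ]
      calc M * (‖z‖ ^ k * ‖z‖) < M * (‖z‖ ^ k * 1) := by gcongr
        _ = M * ‖z‖ ^ k := by rw [mul_one]
  have hother : ∀ j, j ≠ k → ‖T j‖ ≤ M' := by
    intro j hj
    rw [hT]
    rcases lt_or_gt_of_ne hj with hlt | hgt
    · calc ‖b j‖ * ‖z‖ ^ j ≤ ‖b j‖ * 1 := by
            gcongr; exact pow_le_one₀ (norm_nonneg _) hz.le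
        _ = (p : ℝ)⁻¹ * ((p : ℝ) * ‖b j‖) := by field_simp
        _ ≤ (p : ℝ)⁻¹ * M := by gcongr; exact hsmall j hlt
        _ ≤ M' := le_max_left _ _
    · calc ‖b j‖ * ‖z‖ ^ j ≤ M * ‖z‖ ^ (k + 1) :=
            mul_le_mul (hbd j) (pow_le_pow_of_le_one (norm_nonneg _) hz.le hgt) (by positivity)
              hM.le
        _ ≤ M' := le_max_right _ _
  -- `V − T k` is the sum of the other terms
  have hW : HasSum (fun j ↦ if j = k then (0 : ℂ_[p]) else T j) (V - T k) := by
    have h1 : HasSum (fun j ↦ T j - if j = k then T k else 0) (V - T k) :=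
      h.sub (hasSum_ite_eq k (T k))
    refine h1.congr_fun fun j ↦ ?_
    by_cases hj : j = k
    · subst hj; simp
    · simp [hj]
  have hWle : ‖V - T k‖ ≤ M' := by
    refine norm_le_of_hasSum_of_forall_norm_le hM'0 (fun j ↦ ?_) hW
    by_cases hj : j = k
    · simp only [hj, if_true, norm_zero]; exact hM'0
    · simp only [hj, if_false]; exact hother j hj
  have hTk : ‖T k‖ = M * ‖z‖ ^ k := by rw [hT, hk]
  have hlt : ‖V - T k‖ < ‖T k‖ := by rw [hTk]; exact lt_of_le_of_lt hWle hM'lt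
  calc ‖V‖ = ‖T k + (V - T k)‖ := by rw [add_sub_cancel]
    _ = max ‖T k‖ ‖V - T k‖ := IsUltrametricDist.norm_add_eq_max_of_norm_ne_norm hlt.ne'
    _ = ‖T k‖ := max_eq_left hlt.le
    _ = M * ‖z‖ ^ k := hTk

/-- **No dominant term ⟹ small value.** With the bound `‖b_j‖ ≤ p^c`: if NO index `j` with
`‖z‖^j > p⁻¹` has `‖b_j‖ = p^c`, then every term is `≤ p^{c−1}` and `‖V‖ ≤ p^{c−1}`. [folklore] -/
theorem norm_le_of_hasSum_of_forall {b : ℕ → ℚ_[p]} {z V : ℂ_[p]} {c : ℕ}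
    (hbd : ∀ j, ‖b j‖ ≤ (p : ℝ) ^ c) (hz : ‖z‖ < 1)
    (h : HasSum (fun j ↦ algebraMap ℚ_[p] ℂ_[p] (b j) * z ^ j) V)
    (hall : ∀ j, (p : ℝ)⁻¹ < ‖z‖ ^ j → ‖b j‖ < (p : ℝ) ^ c) :
    ‖V‖ ≤ (p : ℝ) ^ c * (p : ℝ)⁻¹ := by
  have hp0 : (0 : ℝ) < p := by exact_mod_cast hp.out.pos
  refine norm_le_of_hasSum_of_forall_norm_le (by positivity) (fun j ↦ ?_) h
  rw [norm_mul, norm_algebraMap', norm_pow]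
  by_cases hj : (p : ℝ)⁻¹ < ‖z‖ ^ j
  · have hsmall := mul_norm_le_pow_of_norm_lt_pow (hall j hj)
    calc ‖b j‖ * ‖z‖ ^ j ≤ ‖b j‖ * 1 := by
          gcongr; exact pow_le_one₀ (norm_nonneg _) hz.le
      _ = (p : ℝ)⁻¹ * ((p : ℝ) * ‖b j‖) := by field_simp
      _ ≤ (p : ℝ)⁻¹ * (p : ℝ) ^ c := by gcongr
      _ = (p : ℝ) ^ c * (p : ℝ)⁻¹ := mul_comm _ _
  · rw [not_lt] at hj
    exact mul_le_mul (hbd j) hj (by positivity) (by positivity)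

/-- **The first top coefficient inside the critical radius reads the value.** With the bound `p^c`:
if SOME index `j` with `‖z‖^j > p⁻¹` has `‖b_j‖ = p^c`, let `k` be the least; then every earlier
coefficient is `< p^c` and `‖V‖ = p^c·‖z‖^k`. [cite: Washington1997, §7.1 (shape)] -/
theorem norm_eq_of_hasSum_of_exists {b : ℕ → ℚ_[p]} {z V : ℂ_[p]} {c : ℕ}
    (hbd : ∀ j, ‖b j‖ ≤ (p : ℝ) ^ c) (hz : ‖z‖ < 1)
    (h : HasSum (fun j ↦ algebraMap ℚ_[p] ℂ_[p] (b j) * z ^ j) V)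
    (hex : ∃ j, (p : ℝ)⁻¹ < ‖z‖ ^ j ∧ ‖b j‖ = (p : ℝ) ^ c) :
    ‖V‖ = (p : ℝ) ^ c * ‖z‖ ^ Nat.find hex ∧ ∀ i < Nat.find hex, ‖b i‖ < (p : ℝ) ^ c := by
  have hp0 : (0 : ℝ) < p := by exact_mod_cast hp.out.pos
  obtain ⟨hzk, hk⟩ := Nat.find_spec hex
  have hlt : ∀ i < Nat.find hex, ‖b i‖ < (p : ℝ) ^ c := by
    intro i hi
    have hmin := Nat.find_min hex hi
    have hzi : (p : ℝ)⁻¹ < ‖z‖ ^ i :=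
      lt_of_lt_of_le hzk (pow_le_pow_of_le_one (norm_nonneg _) hz.le hi.le)
    exact lt_of_le_of_ne (hbd i) fun heq ↦ hmin ⟨hzi, heq⟩
  exact ⟨norm_eq_of_hasSum_of_firstTop hbd (fun i hi ↦ mul_norm_le_pow_of_norm_lt_pow (hlt i hi))
    hk (pow_pos hp0 c) hz hzk h, hlt⟩

/-- **ONE VALUE above `p^{c−1}` locates the first top coefficient.** If `‖V‖ > p^{c−1}` then there is
an index `k` with `‖z‖^k > p⁻¹`, `‖b_k‖ = p^c`, `‖b_i‖ < p^c` for `i < k`, and `‖V‖ = p^c·‖z‖^k`.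
[cite: Washington1997, §7.1–7.2 (shape: `μ = 0` and `λ` from one value)] -/
theorem exists_firstTop_of_lt_norm {b : ℕ → ℚ_[p]} {z V : ℂ_[p]} {c : ℕ}
    (hbd : ∀ j, ‖b j‖ ≤ (p : ℝ) ^ c) (hz : ‖z‖ < 1)
    (h : HasSum (fun j ↦ algebraMap ℚ_[p] ℂ_[p] (b j) * z ^ j) V)
    (hV : (p : ℝ) ^ c * (p : ℝ)⁻¹ < ‖V‖) :
    ∃ k, (p : ℝ)⁻¹ < ‖z‖ ^ k ∧ ‖b k‖ = (p : ℝ) ^ c ∧ (∀ i < k, ‖b i‖ < (p : ℝ) ^ c) ∧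
      ‖V‖ = (p : ℝ) ^ c * ‖z‖ ^ k := by
  by_cases hex : ∃ j, (p : ℝ)⁻¹ < ‖z‖ ^ j ∧ ‖b j‖ = (p : ℝ) ^ c
  · obtain ⟨hV', hlt⟩ := norm_eq_of_hasSum_of_exists hbd hz h hex
    exact ⟨Nat.find hex, (Nat.find_spec hex).1, (Nat.find_spec hex).2, hlt, hV'⟩
  · push Not at hex
    have hle := norm_le_of_hasSum_of_forall hbd hz h fun j hj ↦ lt_of_le_of_ne (hbd j) (hex j hj)
    exact absurd hV (not_lt.mpr hle)

/-- **The exact value pins the index.** If `‖V‖ = p^c·‖z‖^k` with `‖z‖^k > p⁻¹` then `‖b_k‖ = p^c`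
and `‖b_i‖ < p^c` for all `i < k`. [cite: Washington1997, §7.1–7.2 (shape)] -/
theorem firstTop_of_norm_eq {b : ℕ → ℚ_[p]} {z V : ℂ_[p]} {c k : ℕ}
    (hbd : ∀ j, ‖b j‖ ≤ (p : ℝ) ^ c) (hz : ‖z‖ < 1)
    (h : HasSum (fun j ↦ algebraMap ℚ_[p] ℂ_[p] (b j) * z ^ j) V)
    (hzk : (p : ℝ)⁻¹ < ‖z‖ ^ k) (hV : ‖V‖ = (p : ℝ) ^ c * ‖z‖ ^ k) :
    ‖b k‖ = (p : ℝ) ^ c ∧ ∀ i < k, ‖b i‖ < (p : ℝ) ^ c := by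
  have hp0 : (0 : ℝ) < p := by exact_mod_cast hp.out.pos
  have hpc : (0 : ℝ) < (p : ℝ) ^ c := pow_pos hp0 c
  have hV' : (p : ℝ) ^ c * (p : ℝ)⁻¹ < ‖V‖ := by rw [hV]; gcongr
  obtain ⟨k', hzk', hk', hlt', hV''⟩ := exists_firstTop_of_lt_norm hbd hz h hV'
  have hpow : ‖z‖ ^ k = ‖z‖ ^ k' := mul_left_cancel₀ hpc.ne' (hV.symm.trans hV'')
  have hkk : k = k' := by
    rcases (norm_nonneg z).eq_or_lt with hz0 | hz0
    · -- `z = 0`: both exponents vanish since `‖z‖^k, ‖z‖^{k'} > p⁻¹ > 0`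
      have hk0 : k = 0 := by
        by_contra hne
        rw [← hz0, zero_pow hne] at hzk
        exact absurd hzk (not_lt.mpr (inv_pos.mpr hp0).le)
      have hk0' : k' = 0 := by
        by_contra hne
        rw [← hz0, zero_pow hne] at hzk'
        exact absurd hzk' (not_lt.mpr (inv_pos.mpr hp0).le)
      rw [hk0, hk0']
    · exact pow_right_injective₀ hz0 hz.ne hpow
  subst hkk
  exact ⟨hk', hlt'⟩

/-- **The undetermined regime, both ways**: `‖V‖ ≤ p^{c−1}` iff no index `j` with `‖z‖^j > p⁻¹`
carries a coefficient of norm `p^c` ("`μ ≥ 1` or `λ` beyond the critical index", relative to the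
bound `p^c`). [cite: Washington1997, §7.1–7.2 (shape)] -/
theorem norm_le_iff_forall {b : ℕ → ℚ_[p]} {z V : ℂ_[p]} {c : ℕ}
    (hbd : ∀ j, ‖b j‖ ≤ (p : ℝ) ^ c) (hz : ‖z‖ < 1)
    (h : HasSum (fun j ↦ algebraMap ℚ_[p] ℂ_[p] (b j) * z ^ j) V) :
    ‖V‖ ≤ (p : ℝ) ^ c * (p : ℝ)⁻¹ ↔ ∀ j, (p : ℝ)⁻¹ < ‖z‖ ^ j → ‖b j‖ < (p : ℝ) ^ c := by
  have hp0 : (0 : ℝ) < p := by exact_mod_cast hp.out.pos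
  refine ⟨fun hle j hj ↦ lt_of_le_of_ne (hbd j) fun heq ↦ ?_, norm_le_of_hasSum_of_forall hbd hz h⟩
  have hex : ∃ j, (p : ℝ)⁻¹ < ‖z‖ ^ j ∧ ‖b j‖ = (p : ℝ) ^ c := ⟨j, hj, heq⟩
  obtain ⟨hV, -⟩ := norm_eq_of_hasSum_of_exists hbd hz h hex
  have hzk := (Nat.find_spec hex).1
  have hgt : (p : ℝ) ^ c * (p : ℝ)⁻¹ < ‖V‖ := by rw [hV]; gcongr
  exact absurd hle (not_le.mpr hgt)

end Eval

end TameBranchOneValue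

/-! ### §2 The interpolation row: EVERY witness of the package, ONE wild character -/

section Row

open TameBranchOneValue

variable {p : ℕ} [hp : Fact p.Prime] {N : ℕ} {f : CuspForm (Gamma0 N) 2}

/-- The norm of the right-hand side of the interpolation row: for `‖α‖ = 1`,
`‖α^{−m}p⁻¹·τ(ε,ψ_κ)·S(κ)‖ = p·‖τ(ε,ψ_κ)‖·‖S(κ)‖`. [folklore] -/
theorem norm_tameBranchRow_eq {ε : DirichletCharacter ℂ_[p] p} {α : ℚ_[p]} (hα : ‖α‖ = 1) (m : ℕ)
    (κ : DirichletCharacter ℂ_[p] (p ^ m)) :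
    ‖algebraMap ℚ_[p] ℂ_[p] (α⁻¹ ^ m * (p : ℚ_[p])⁻¹) * tameGaussSum p ε κ *
        ratTwistedSymbolSum f κ‖ =
      (p : ℝ) * ‖tameGaussSum p ε κ‖ * ‖ratTwistedSymbolSum f κ‖ := by
  have hconst : ‖algebraMap ℚ_[p] ℂ_[p] (α⁻¹ ^ m * (p : ℚ_[p])⁻¹)‖ = (p : ℝ) := by
    rw [norm_algebraMap', norm_mul, norm_pow, norm_inv, hα, inv_one, one_pow, one_mul, norm_inv,
      Padic.norm_p, inv_inv]
  rw [norm_mul, norm_mul, hconst]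

/-- **PREDICTION (row form).** For EVERY witness `B` of `IsTameBranchOf f p ε α B` with `‖α‖ = 1` and
coefficient bound `p^c` whose FIRST coefficient of norm `p^c` sits at index `k` (`λ_an = k`,
`μ_an = −c` in the normalisation of the bound), and every even primitive wild `κ` of conductor
`p^m ≥ p²` and `p`-power order with `‖κ(γ) − 1‖^k > p⁻¹`:
**`p·‖τ(ε,ψ_κ)‖·‖Σ_b κ(b)[b/p^m]⁺_f‖ = p^c·‖κ(γ) − 1‖^k`** — gen 26's inequality
`IsTameBranchOf.mul_norm_tameGaussSum_mul_norm_le` made exact.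
[cite: MazurTateTeitelbaum1986Invent, §I.8, §I.14 (14.3)] [cite: Washington1997, §7.1 (shape)] -/
theorem IsTameBranchOf.mul_norm_tameGaussSum_mul_norm_eq_of_firstTop
    {ε : DirichletCharacter ℂ_[p] p} {α : ℚ_[p]} {B : PowerSeries ℚ_[p]}
    (h : IsTameBranchOf f p ε α B) (hα : ‖α‖ = 1) {c : ℕ}
    (hbd : ∀ j : ℕ, ‖PowerSeries.coeff j B‖ ≤ (p : ℝ) ^ c)
    {k : ℕ} (hk : ‖PowerSeries.coeff k B‖ = (p : ℝ) ^ c)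
    (hlt : ∀ i < k, ‖PowerSeries.coeff i B‖ < (p : ℝ) ^ c)
    {m : ℕ} (hm : 2 ≤ m) {κ : DirichletCharacter ℂ_[p] (p ^ m)} (hκ : κ.IsPrimitive) (heven : κ.Even)
    (hord : ∃ j : ℕ, orderOf κ = p ^ j)
    (hzk : (p : ℝ)⁻¹ < ‖κ (cyclotomicGenerator p : ZMod (p ^ m)) - 1‖ ^ k) :
    (p : ℝ) * ‖tameGaussSum p ε κ‖ * ‖ratTwistedSymbolSum f κ‖ =
      (p : ℝ) ^ c * ‖κ (cyclotomicGenerator p : ZMod (p ^ m)) - 1‖ ^ k := by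
  have hp0 : (0 : ℝ) < p := by exact_mod_cast hp.out.pos
  rw [← norm_tameBranchRow_eq hα m κ]
  exact norm_eq_of_hasSum_of_firstTop hbd (fun i hi ↦ mul_norm_le_pow_of_norm_lt_pow (hlt i hi)) hk
    (pow_pos hp0 c) (norm_apply_cyclotomicGenerator_sub_one_lt κ hord) hzk
    (h.2.2 m hm κ hκ heven hord)

/-- **THE ONE-VALUE CERTIFICATE (row form).** For EVERY witness `B` of `IsTameBranchOf f p ε α B`
with `‖α‖ = 1` and coefficient bound `p^c`, and ONE even primitive wild `κ` of conductor `p^m ≥ p²`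
with `‖κ(γ) − 1‖^k > p⁻¹`: if **`p·‖τ(ε,ψ_κ)‖·‖Σ_b κ(b)[b/p^m]⁺_f‖ = p^c·‖κ(γ) − 1‖^k`** then
**`‖[T^k]B‖ = p^c` and `‖[T^i]B‖ < p^c` for `i < k`** — the input of gen 24's at-the-bound discharge
of `CharLamLeAt W p k`, read off one twisted symbol sum instead of a Riemann sum.
[cite: MazurTateTeitelbaum1986Invent, §I.8, §I.14 (14.3)] [cite: Washington1997, §7.1–7.2 (shape)] -/
theorem IsTameBranchOf.firstTop_of_mul_norm_tameGaussSum_mul_norm_eq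
    {ε : DirichletCharacter ℂ_[p] p} {α : ℚ_[p]} {B : PowerSeries ℚ_[p]}
    (h : IsTameBranchOf f p ε α B) (hα : ‖α‖ = 1) {c : ℕ}
    (hbd : ∀ j : ℕ, ‖PowerSeries.coeff j B‖ ≤ (p : ℝ) ^ c)
    {m : ℕ} (hm : 2 ≤ m) {κ : DirichletCharacter ℂ_[p] (p ^ m)} (hκ : κ.IsPrimitive) (heven : κ.Even)
    (hord : ∃ j : ℕ, orderOf κ = p ^ j) {k : ℕ}
    (hzk : (p : ℝ)⁻¹ < ‖κ (cyclotomicGenerator p : ZMod (p ^ m)) - 1‖ ^ k)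
    (hval : (p : ℝ) * ‖tameGaussSum p ε κ‖ * ‖ratTwistedSymbolSum f κ‖ =
      (p : ℝ) ^ c * ‖κ (cyclotomicGenerator p : ZMod (p ^ m)) - 1‖ ^ k) :
    ‖PowerSeries.coeff k B‖ = (p : ℝ) ^ c ∧ ∀ i < k, ‖PowerSeries.coeff i B‖ < (p : ℝ) ^ c := by
  rw [← norm_tameBranchRow_eq hα m κ] at hval
  exact firstTop_of_norm_eq hbd (norm_apply_cyclotomicGenerator_sub_one_lt κ hord)
    (h.2.2 m hm κ hκ heven hord) hzk hval

/-- **ONE VALUE above `p^{c−1}` locates `λ_an`** (row form): for every witness with bound `p^c`, if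
`p·‖τ(ε,ψ_κ)‖·‖S(κ)‖ > p^{c−1}` for one even primitive wild `κ` of conductor `p^m ≥ p²`, then for
some `k` with `‖κ(γ)−1‖^k > p⁻¹`: `‖[T^k]B‖ = p^c` is the first top coefficient and
`p‖τ‖‖S(κ)‖ = p^c‖κ(γ)−1‖^k`. [cite: MazurTateTeitelbaum1986Invent, §I.8, §I.14 (14.3)]
[cite: Washington1997, §7.1–7.2 (shape)] -/
theorem IsTameBranchOf.exists_firstTop_of_lt_mul_norm_tameGaussSum_mul_norm
    {ε : DirichletCharacter ℂ_[p] p} {α : ℚ_[p]} {B : PowerSeries ℚ_[p]}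
    (h : IsTameBranchOf f p ε α B) (hα : ‖α‖ = 1) {c : ℕ}
    (hbd : ∀ j : ℕ, ‖PowerSeries.coeff j B‖ ≤ (p : ℝ) ^ c)
    {m : ℕ} (hm : 2 ≤ m) {κ : DirichletCharacter ℂ_[p] (p ^ m)} (hκ : κ.IsPrimitive) (heven : κ.Even)
    (hord : ∃ j : ℕ, orderOf κ = p ^ j)
    (hgt : (p : ℝ) ^ c * (p : ℝ)⁻¹ <
      (p : ℝ) * ‖tameGaussSum p ε κ‖ * ‖ratTwistedSymbolSum f κ‖) :
    ∃ k : ℕ, (p : ℝ)⁻¹ < ‖κ (cyclotomicGenerator p : ZMod (p ^ m)) - 1‖ ^ k ∧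
      ‖PowerSeries.coeff k B‖ = (p : ℝ) ^ c ∧ (∀ i < k, ‖PowerSeries.coeff i B‖ < (p : ℝ) ^ c) ∧
      (p : ℝ) * ‖tameGaussSum p ε κ‖ * ‖ratTwistedSymbolSum f κ‖ =
        (p : ℝ) ^ c * ‖κ (cyclotomicGenerator p : ZMod (p ^ m)) - 1‖ ^ k := by
  rw [← norm_tameBranchRow_eq hα m κ] at hgt ⊢
  exact exists_firstTop_of_lt_norm hbd (norm_apply_cyclotomicGenerator_sub_one_lt κ hord)
    (h.2.2 m hm κ hκ heven hord) hgt

/-- **The undetermined regime (row form)**: `p·‖τ(ε,ψ_κ)‖·‖S(κ)‖ ≤ p^{c−1}` iff NO index `j` with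
`‖κ(γ)−1‖^j > p⁻¹` has `‖[T^j]B‖ = p^c`. [cite: MazurTateTeitelbaum1986Invent, §I.8, §I.14 (14.3)]
[cite: Washington1997, §7.1–7.2 (shape)] -/
theorem IsTameBranchOf.mul_norm_tameGaussSum_mul_norm_le_iff_forall
    {ε : DirichletCharacter ℂ_[p] p} {α : ℚ_[p]} {B : PowerSeries ℚ_[p]}
    (h : IsTameBranchOf f p ε α B) (hα : ‖α‖ = 1) {c : ℕ}
    (hbd : ∀ j : ℕ, ‖PowerSeries.coeff j B‖ ≤ (p : ℝ) ^ c)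
    {m : ℕ} (hm : 2 ≤ m) {κ : DirichletCharacter ℂ_[p] (p ^ m)} (hκ : κ.IsPrimitive) (heven : κ.Even)
    (hord : ∃ j : ℕ, orderOf κ = p ^ j) :
    (p : ℝ) * ‖tameGaussSum p ε κ‖ * ‖ratTwistedSymbolSum f κ‖ ≤ (p : ℝ) ^ c * (p : ℝ)⁻¹ ↔
      ∀ j : ℕ, (p : ℝ)⁻¹ < ‖κ (cyclotomicGenerator p : ZMod (p ^ m)) - 1‖ ^ j →
        ‖PowerSeries.coeff j B‖ < (p : ℝ) ^ c := by
  rw [← norm_tameBranchRow_eq hα m κ]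
  exact norm_le_iff_forall hbd (norm_apply_cyclotomicGenerator_sub_one_lt κ hord)
    (h.2.2 m hm κ hκ heven hord)

end Row

end Summit.BirchSwinnertonDyer.Rank1Residual.Additive

end
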